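import Literature.NumberTheory.DiophantineGeometry.GarciaStichtenothProfiles
import Literature.NumberTheory.DiophantineGeometry.GarciaStichtenothDifferential
import HarnessLib

/-!
# The Garcia–Stichtenoth tower: the divisor of `dx₀` at every place (Stichtenoth Lemma 7.4.6,
`d(Q|P) = 2e(Q|P) - 2`)

Topic: `Literature/NumberTheory/DiophantineGeometry` (sub-namespace `GSTower`). Combining the place
profiles of `GarciaStichtenothProfiles` with the local bounds of `GarciaStichtenothDifferential`, we
bound the divisor `W = (dx₀)` of a level `G_N` at every place `Q`:

* `W(P_∞) ≤ -2` (`Level.differentialDivisor_Pinf_le`);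
* `W(Q) ≤ 0` at a place in general position (`Level.differentialDivisor_le_of_generic`);
* `W(Q) ≤ 2 v_Q(x₀ - β) - 2` at a place above `x₀ = β`, `β ∈ 𝔽_q`
  (`Level.differentialDivisor_le_of_bad`).

The last bound is exactly [Stichtenoth 2009, Lemma 7.4.6] `d(Q|P) = 2e(Q|P) - 2` read through
`(dx₀)_Q = e(Q|P)·(dx₀)_P + d(Q|P)` (Remark 4.3.7), here obtained without differents: in the ramified
range the conversion factor `g = ∏ D(x_i)` has `v_Q(g) = -2q^{N-2t}` (`Level.ord_convFactor_of_bad`).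

## References

* H. Stichtenoth, *Algebraic Function Fields and Codes*, 2nd ed., GTM 254 (2009): Lemma 7.4.6,
  Remark 4.3.7, Thm. 3.4.6. [Stichtenoth2009]
-/

noncomputable section

open scoped Classical Polynomial IntermediateField
open Polynomial

namespace Literature.NumberTheory.DiophantineGeometry

open AlgFunctionField

namespace GSTower

universe u v

/-! ### Orders of `D(z) = z^{2q-2}/(1 - z^{q-1})²` -/

section OrdD

variable {K : Type u} {F : Type v} [Field K] [Field F] [Algebra K F]

/-- The order of a finite product is the sum of the orders (all factors non-zero). [folklore] -/
theorem ord_prod (P : PlaceOver K F) {ι : Type*} (s : Finset ι) (f : ι → F) (hf : ∀ i ∈ s, f i ≠ 0) :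
    P.ord (∏ i ∈ s, f i) = ∑ i ∈ s, P.ord (f i) := by
  induction s using Finset.induction_on with
  | empty => rw [Finset.prod_empty, Finset.sum_empty, P.ord_one]
  | insert a s ha ih =>
    rw [Finset.prod_insert ha, Finset.sum_insert ha, P.ord_mul_eq (hf a (Finset.mem_insert_self a s))
      (Finset.prod_ne_zero_iff.2 fun i hi => hf i (Finset.mem_insert_of_mem hi)),
      ih fun i hi => hf i (Finset.mem_insert_of_mem hi)]

/-- At a pole of `z`, `D(z)` is a unit: `v(z^{2q-2}) = v((1 - z^{q-1})²)`. [cite: Stichtenoth2009, Lemma 7.4.6 (proof)] -/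
theorem ord_D_of_ord_neg (P : PlaceOver K F) {q : ℕ} (hq : 2 ≤ q) {z : F} (hz : P.ord z < 0) :
    z ^ (2 * q - 2) / (1 - z ^ (q - 1)) ^ 2 ≠ 0 ∧ P.ord (z ^ (2 * q - 2) / (1 - z ^ (q - 1)) ^ 2) = 0 := by
  have hz0 : z ≠ 0 := P.ne_zero_of_ord_ne_zero hz.ne
  obtain ⟨⟨h1, hord1⟩, -⟩ := ord_u_of_ord_neg P hq hz
  refine ⟨div_ne_zero (pow_ne_zero _ hz0) (pow_ne_zero _ h1), ?_⟩
  rw [P.ord_div (pow_ne_zero _ hz0) (pow_ne_zero _ h1), P.ord_pow hz0, P.ord_pow h1, hord1]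
  have : ((2 * q - 2 : ℕ) : ℤ) = 2 * ((q - 1 : ℕ) : ℤ) := by omega
  rw [this]; ring

/-- At a zero of `z`, `1 - z^{q-1}` is a unit and `v(D(z)) = (2q-2) v(z)`.
[cite: Stichtenoth2009, Lemma 7.4.6 (proof)] -/
theorem ord_D_of_ord_pos (P : PlaceOver K F) {q : ℕ} (hq : 2 ≤ q) {z : F} (hz : 0 < P.ord z) :
    z ^ (2 * q - 2) / (1 - z ^ (q - 1)) ^ 2 ≠ 0 ∧
      P.ord (z ^ (2 * q - 2) / (1 - z ^ (q - 1)) ^ 2) = ((2 * q - 2 : ℕ) : ℤ) * P.ord z := by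
  have hz0 : z ≠ 0 := P.ne_zero_of_ord_ne_zero hz.ne'
  have hlt : P.ord (1 : F) < P.ord (-z ^ (q - 1)) := by
    rw [P.ord_one, P.ord_neg, P.ord_pow hz0]
    have : (1 : ℤ) ≤ ((q - 1 : ℕ) : ℤ) := by omega
    nlinarith
  have hst := P.ord_add_eq_left_of_lt one_ne_zero (neg_ne_zero.2 (pow_ne_zero _ hz0)) hlt
  rw [← sub_eq_add_neg, P.ord_one] at hst
  refine ⟨div_ne_zero (pow_ne_zero _ hz0) (pow_ne_zero _ hst.1), ?_⟩
  rw [P.ord_div (pow_ne_zero _ hz0) (pow_ne_zero _ hst.1), P.ord_pow hz0, P.ord_pow hst.1, hst.2, mul_zero,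
    sub_zero]

/-- **`v(1 - z^{q-1}) = v(z - α)` when `z ≡ α`, `α ∈ 𝔽_q^×`** (`q = 0` in `K`): `1 - z^{q-1} = -(z - α) S(z)`
with `S(z) ≡ (q-1)α^{q-2} ≠ 0`. [cite: Stichtenoth2009, Lemma 7.4.6 (proof)] -/
theorem ord_one_sub_pow_of_equiv [IsAlgFunctionField K F] (P : PlaceOver K F) {q : ℕ} (hq : 2 ≤ q)
    (hqK : (q : K) = 0) {α : K} (hαq : α ^ q = α) (hα0 : α ≠ 0) {z : F}
    (hz : 0 < P.ord (z - algebraMap K F α)) :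
    1 - z ^ (q - 1) ≠ 0 ∧ P.ord (1 - z ^ (q - 1)) = P.ord (z - algebraMap K F α) := by
  set a := algebraMap K F α with ha
  have hδ0 : z - a ≠ 0 := P.ne_zero_of_ord_ne_zero hz.ne'
  have hza : z ≠ a := sub_ne_zero.1 hδ0
  have hαpow : α ^ (q - 1) = 1 := by
    have : α ^ (q - 1) * α = 1 * α := by rw [← pow_succ, Nat.sub_add_cancel (by omega), hαq, one_mul]
    exact mul_right_cancel₀ hα0 this
  set S : K[X] := ∑ i ∈ Finset.range (q - 1), X ^ i * C α ^ (q - 1 - 1 - i) with hS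
  have hSmul : S * (X - C α) = X ^ (q - 1) - 1 := by
    rw [hS, geom_sum₂_mul, ← C_pow, hαpow, C_1]
  have hSeval : S.eval α = ((q - 1 : ℕ) : K) * α ^ (q - 2) := by
    rw [hS, eval_finsetSum]
    simp only [eval_mul, eval_pow, eval_X, eval_C]
    rw [Finset.sum_congr rfl fun i (hi : i ∈ Finset.range (q - 1)) => by
      rw [← pow_add, show i + (q - 1 - 1 - i) = q - 2 by
        have := Finset.mem_range.1 hi; omega]]
    rw [Finset.sum_const, Finset.card_range, nsmul_eq_mul]
  have hcast : ((q - 1 : ℕ) : K) + 1 = (q : K) := by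
    rw [← Nat.cast_add_one]; congr 1; omega
  have hSeval0 : S.eval α ≠ 0 := by
    rw [hSeval]
    refine mul_ne_zero ?_ (pow_ne_zero _ hα0)
    have : ((q - 1 : ℕ) : K) = -1 := by
      rw [hqK] at hcast; exact eq_neg_of_add_eq_zero_left hcast
    rw [this]; exact neg_ne_zero.2 one_ne_zero
  have hSz : P.valuation (aeval z S) = 1 := P.valuation_aeval_eq_one hz hza S hSeval0
  have hSz0 : aeval z S ≠ 0 := by
    intro h0; rw [h0, Valuation.map_zero] at hSz; exact zero_ne_one hSz
  have h1z : 1 - z ^ (q - 1) = -((z - a) * aeval z S) := by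
    have := congrArg (aeval z) hSmul
    rw [map_mul, map_sub, aeval_X, aeval_C, map_sub, map_pow, aeval_X, map_one] at this
    linear_combination this
  have hordS : P.ord (aeval z S) = 0 := (P.valuation_eq_zpow_iff_ord_eq hSz0 0).1 (by rw [zpow_zero, hSz])
  refine ⟨by rw [h1z]; exact neg_ne_zero.2 (mul_ne_zero hδ0 hSz0), ?_⟩
  rw [h1z, P.ord_neg, P.ord_mul_eq hδ0 hSz0, hordS, add_zero]

/-- At a place with `z ≡ α ∈ 𝔽_q^×`, `v(D(z)) = -2 v(z - α)`. [cite: Stichtenoth2009, Lemma 7.4.6 (proof)] -/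
theorem ord_D_of_equiv [IsAlgFunctionField K F] (P : PlaceOver K F) {q : ℕ} (hq : 2 ≤ q)
    (hqK : (q : K) = 0) {α : K} (hαq : α ^ q = α) (hα0 : α ≠ 0) {z : F}
    (hz : 0 < P.ord (z - algebraMap K F α)) :
    z ^ (2 * q - 2) / (1 - z ^ (q - 1)) ^ 2 ≠ 0 ∧
      P.ord (z ^ (2 * q - 2) / (1 - z ^ (q - 1)) ^ 2) = -2 * P.ord (z - algebraMap K F α) := by
  obtain ⟨h1, hord1⟩ := ord_one_sub_pow_of_equiv P hq hqK hαq hα0 hz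
  have ha0 : algebraMap K F α ≠ 0 := (_root_.map_ne_zero _).2 hα0
  have hδ0 : z - algebraMap K F α ≠ 0 := P.ne_zero_of_ord_ne_zero hz.ne'
  -- `v(z) = 0`
  have hz0 : z ≠ 0 := by
    rintro rfl
    rw [zero_sub, P.ord_neg, PlaceOver.ord_algebraMap_holds P hα0] at hz
    exact lt_irrefl _ hz
  have hordz : P.ord z = 0 := by
    have hlt : P.ord (algebraMap K F α) < P.ord (z - algebraMap K F α) := by
      rw [PlaceOver.ord_algebraMap_holds P hα0]; exact hz
    have hst := P.ord_add_eq_left_of_lt ha0 hδ0 hlt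
    rw [add_sub_cancel, PlaceOver.ord_algebraMap_holds P hα0] at hst
    exact hst.2
  refine ⟨div_ne_zero (pow_ne_zero _ hz0) (pow_ne_zero _ h1), ?_⟩
  rw [P.ord_div (pow_ne_zero _ hz0) (pow_ne_zero _ h1), P.ord_pow hz0, P.ord_pow h1, hordz, hord1]
  ring

end OrdD

/-! ### The conversion factor `g = ∏_{i<N} D(x_i)` at `P_∞` and at the bad places -/

namespace Level

variable {K : Type} [Field K] {q : ℕ} [hq : Fact (2 ≤ q)] (L : Level K q)

/-- `v_{P_∞}(g) = 0`: every `x_i` has a pole at `P_∞`. [cite: Stichtenoth2009, Lemma 7.4.6] -/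
theorem ord_convFactor_Pinf :
    L.Pinf.ord (∏ i ∈ Finset.range L.N, (L.x i ^ (2 * q - 2) / (1 - L.x i ^ (q - 1)) ^ 2)) = 0 := by
  rw [ord_prod _ _ _ fun i hi => (ord_D_of_ord_neg L.Pinf hq.out (by
    rw [L.ord_Pinf i (by have := Finset.mem_range.1 hi; omega)]
    exact neg_neg_of_pos (by have := hq.out; positivity))).1]
  exact Finset.sum_eq_zero fun i hi => (ord_D_of_ord_neg L.Pinf hq.out (by
    rw [L.ord_Pinf i (by have := Finset.mem_range.1 hi; omega)]
    exact neg_neg_of_pos (by have := hq.out; positivity))).2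

/-- **`v_Q(g) = -2q^{N-2t}` at a bad place in the ramified range** `2t + 1 ≤ N`: the generators
`x_i`, `i < t`, contribute `(2q-2) q^{N-2t} q^i`, `x_t` contributes `-2 q^{N-2t} q^t`, the poles
nothing. [cite: Stichtenoth2009, Lemma 7.4.6] -/
theorem ord_convFactor_of_bad (hqK : (q : K) = 0) {Q : PlaceOver K L.carrier} {β : K} {t : ℕ} {α : K}
    (hbad : L.BadProfile Q β t α) (h2t : 2 * t + 1 ≤ L.N) :
    Q.ord (∏ i ∈ Finset.range L.N, (L.x i ^ (2 * q - 2) / (1 - L.x i ^ (q - 1)) ^ 2)) =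
      -2 * (q : ℤ) ^ (L.N - 2 * t) := by
  have hq2 := hq.out
  set e : ℤ := (q : ℤ) ^ (L.N - 2 * t) with he
  have hne : ∀ i ∈ Finset.range L.N, (L.x i ^ (2 * q - 2) / (1 - L.x i ^ (q - 1)) ^ 2) ≠ 0 := by
    intro i hi
    have hiN := Finset.mem_range.1 hi
    exact div_ne_zero (pow_ne_zero _ (L.x_ne_zero hiN.le)) (pow_ne_zero _ (L.one_sub_pow_ne_zero hiN.le))
  -- the three ranges
  have hlt : ∀ i ∈ Finset.range t, Q.ord (L.x i ^ (2 * q - 2) / (1 - L.x i ^ (q - 1)) ^ 2) =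
      ((2 * q - 2 : ℕ) : ℤ) * e * (q : ℤ) ^ i := by
    intro i hi
    have hit := Finset.mem_range.1 hi
    have hpos : 0 < Q.ord (L.x i) := by rw [hbad.ord_lt i hit (by omega)]; positivity
    rw [(ord_D_of_ord_pos Q hq2 hpos).2, hbad.ord_lt i hit (by omega), he]; ring
  have heq : Q.ord (L.x t ^ (2 * q - 2) / (1 - L.x t ^ (q - 1)) ^ 2) = -2 * (e * (q : ℤ) ^ t) := by
    rw [(ord_D_of_equiv Q hq2 hqK hbad.pow_eq hbad.ne_zero (z := L.x t)
      (by rw [hbad.ord_t (by omega)]; positivity)).2, hbad.ord_t (by omega), he]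
  have hgt : ∀ i ∈ Finset.Ico (t + 1) L.N, Q.ord (L.x i ^ (2 * q - 2) / (1 - L.x i ^ (q - 1)) ^ 2) = 0 := by
    intro i hi
    obtain ⟨hit, hiN⟩ := Finset.mem_Ico.1 hi
    have hneg : Q.ord (L.x i) < 0 := by
      rcases Nat.lt_or_ge (2 * t) i with h2 | h2
      · rw [hbad.ord_gt i h2 hiN.le]; exact neg_neg_of_pos (by positivity)
      · rw [hbad.ord_mid i (by omega) h2 hiN.le]; exact neg_neg_of_pos (by positivity)
    exact (ord_D_of_ord_neg Q hq2 hneg).2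
  rw [ord_prod _ _ _ hne, ← Finset.sum_range_add_sum_Ico _ (by omega : t + 1 ≤ L.N),
    Finset.sum_range_succ, Finset.sum_congr rfl hlt, heq, Finset.sum_eq_zero hgt, add_zero,
    ← Finset.mul_sum]
  have hgeom : (∑ i ∈ Finset.range t, (q : ℤ) ^ i) * ((q : ℤ) - 1) = (q : ℤ) ^ t - 1 := geom_sum_mul _ _
  have hcast : ((2 * q - 2 : ℕ) : ℤ) = 2 * ((q : ℤ) - 1) := by omega
  rw [hcast]
  linear_combination 2 * e * hgeom

/-! ### Local bounds on `(dx₀)` at every place -/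

variable [Finite K]

/-- **At `P_∞`: `dx₀ ≠ 0` and `(dx₀)(P_∞) ≤ -2`.** [cite: Stichtenoth2009, Lemma 7.4.6] -/
theorem differentialDivisor_Pinf_le [IsIntegrallyClosedIn K L.carrier] (hqK : (q : K) = 0) :
    dOf K (L.x 0) ≠ 0 ∧ differentialDivisor (dOf K (L.x 0)) L.Pinf ≤ -2 := by
  obtain ⟨hω, hle⟩ := L.differentialDivisor_le_of_ord_x_N hqK L.ord_Pinf_x_N
  rw [L.ord_convFactor_Pinf] at hle
  exact ⟨hω, by simpa using hle⟩

omit hq in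
/-- **At a place in general position: `(dx₀)(Q) ≤ 0`.** [cite: Stichtenoth2009, Lemma 7.4.5] -/
theorem differentialDivisor_le_of_generic [IsIntegrallyClosedIn K L.carrier] {Q : PlaceOver K L.carrier}
    (h : L.GenericProfile Q) : differentialDivisor (dOf K (L.x 0)) Q ≤ 0 := by
  obtain ⟨f, hf1, hfne, hf0⟩ := h.chart
  exact (L.differentialDivisor_le_of_chart hf1 hfne hf0).2

/-- **At a place above `x₀ = β`, `β ∈ 𝔽_q`: `(dx₀)(Q) ≤ 2 v_Q(x₀ - β) - 2`** (i.e. `d = 2e - 2`,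
Lemma 7.4.6). [cite: Stichtenoth2009, Lemma 7.4.6] -/
theorem differentialDivisor_le_of_bad [IsIntegrallyClosedIn K L.carrier] (hqK : (q : K) = 0)
    {Q : PlaceOver K L.carrier} {β : K} {t : ℕ} {α : K} (hbad : L.BadProfile Q β t α) :
    differentialDivisor (dOf K (L.x 0)) Q ≤ 2 * Q.ord (L.x 0 - algebraMap K L.carrier β) - 2 := by
  have hq2 := hq.out
  -- `v_Q(x₀ - β) = q^{N - 2t}`
  have hord0 : Q.ord (L.x 0 - algebraMap K L.carrier β) = (q : ℤ) ^ (L.N - 2 * t) := by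
    rcases Nat.eq_zero_or_pos t with rfl | ht
    · by_cases hβ : β = 0
      · have := hbad.one_le_t hβ; omega
      · obtain ⟨-, hαβ⟩ := hbad.t_eq_zero hβ
        rw [← hαβ, hbad.ord_t (Nat.zero_le _), pow_zero, mul_one]
    · have hβ : β = 0 := by by_contra hβ; have := (hbad.t_eq_zero hβ).1; omega
      rw [hβ, map_zero, sub_zero, hbad.ord_lt 0 ht (Nat.zero_le _), pow_zero, mul_one]
  rcases Nat.lt_or_ge L.N (2 * t + 1) with hN | hN
  · -- `N ≤ 2t`: `e = 1`, chart `x₀ - β`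
    have he : L.N - 2 * t = 0 := by omega
    rw [he, pow_zero] at hord0
    have := (L.differentialDivisor_le_of_ord_sub_eq_one hord0).2
    rw [hord0]; linarith
  · -- `2t + 1 ≤ N`: chart `1/x_N`
    have hxN : Q.ord (L.x L.N) = -1 := by rw [hbad.ord_gt L.N (by omega) le_rfl, Nat.sub_self, pow_zero]
    have := (L.differentialDivisor_le_of_ord_x_N hqK hxN).2
    rw [L.ord_convFactor_of_bad hqK hbad hN] at this
    rw [hord0]; linarith

end Level

end GSTower

end Literature.NumberTheory.DiophantineGeometry
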